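import Literature.Geometry.Riemannian.GurskyEinsteinGap
import Literature.Geometry.Riemannian.PinchingEstimatesConstraints
import Literature.Geometry.Riemannian.ChangGurskyYangWeylBudget
import Literature.Geometry.Riemannian.SelfDualMetricFrameProofs
import Literature.Topology.FourManifolds.SmoothOrientationProofs
import Literature.LinearAlgebra.Matrix.PerronSymmetric
import HarnessLib

/-!
# Gursky's Einstein gap on homotopy `4`-spheres: the algebraic lemma `3√6 det W⁺ ≤ |W⁺|³` and
# the reduction of the named fact to its two global curvature inputs (proved)

Companion ("Proofs") file of `Literature/Geometry/Riemannian/GurskyEinsteinGap.lean`, which vends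
the named fact `Literature.Geometry.Riemannian.gursky_einstein_homotopySphere_four` (Gursky 2000,
Thm. 1 + Chern–Gauss–Bonnet + signature formula: an Einstein metric `Ric = λ g`, `λ > 0`, on a
closed smooth `4`-manifold `M ≃ₕ S⁴` has `W ≡ 0` or `vol(M, g) ≤ 8π²/λ²`). The fact is deep and is
NOT discharged here. Sources read: the paywalled original (Gursky, Math. Ann. 318 (2000) 417–431)
is not held; the Einstein case — all the fact uses — is RE-PROVED in the held paper
M. J. Gursky, C. LeBrun, *On Einstein manifolds of positive sectional curvature*, Ann. Global
Anal. Geom. 17 (1999) 315–328 (arXiv:math/9807055), §3 ("a simplified proof of a surprising fact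
discovered in [G1]", [G1] = Gursky 2000), verbatim:

* Lemma 4: "Suppose `(M,g)` is a compact oriented Einstein `4`-manifold of positive scalar
  curvature. Then either `W⁺ ≡ 0`, or else there is a smooth, conformally related metric
  `ĝ = u²g` such that `∫_M [s_ĝ - 2√6 |W⁺_ĝ|_ĝ] dμ_ĝ ≤ 0`." Its proof uses: `δW⁺ = 0` for Einstein
  metrics (second Bianchi identity), the Kato inequality `|∇W⁺| ≥ √(5/3) |∇|W⁺||`, Derdziński's
  Weitzenböck formula `0 = ½Δ|W⁺|² + |∇W⁺|² + (s/2)|W⁺|² - 18 det W⁺`, "the (sharp) algebraic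
  inequality `3√6 det W⁺ ≤ |W⁺|³`", whence `◇u₀ ≤ 0` for `u₀ = |W⁺|^{1/3}`, `◇ = 6Δ + 𝔖`,
  `𝔖 = s - 2√6|W⁺|`, `𝔖_{u²g} = u⁻³◇u`, and a cut-off `f_ε`.
* Theorem 1: "Let `(M,g)` be a compact oriented Einstein `4`-manifold with `s > 0` and `W⁺ ≢ 0`.
  Then `∫_M |W⁺_g|²_g dμ_g ≥ ∫_M s_g²/24 dμ_g`, with equality iff `∇W⁺ ≡ 0`." (Proof: Obata's
  theorem — an Einstein metric minimises `∫ s dμ / √vol` in its conformal class — Lemma 4,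
  Cauchy–Schwarz, conformal invariance of `∫|W⁺|²`.) Corollary 1: the mirror statement for `W⁻`.
* (gb), (sig) (ibid. §2): `χ(M) = (1/8π²)∫[|W₊|² + |W₋|² + s²/24 - |r̊|²/2] dμ`,
  `τ(M) = (1/12π²)∫[|W₊|² - |W₋|²] dμ`; §5: "the `S⁴`-analog of Theorem (C) was only recently
  proved [G1]" — for a non-round Einstein metric on `S⁴`, `𝒮(g) < 𝒮(g₁)/√3`, `𝒮(g₁) = 8π√6`,
  i.e. `16λ² vol < 128π²`, `vol < 8π²/λ²`: the vended fact (with `≤`).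

## What is PROVED here

1. **The sharp algebraic inequality `3√6 det W⁺ ≤ |W⁺|³`** (Gursky–LeBrun 1999, proof of
   Lemma 4; Gursky 2000), for `W⁺_x` what it is algebraically — a trace-free symmetric
   endomorphism of the `3`-dimensional Euclidean space `Λ⁺_x`, i.e. a real symmetric trace-free
   `3 × 3` matrix (in Hamilton's blocks of `CurvatureDecomposition.lean`, `W⁺ = ½(A - (tr A/3)1)`
   in a positive orthonormal frame): `GurskyLeBrun.det_le_normSq_mul_sqrt`
   (`3√6 det W ≤ |W|² √|W|²`, `|W|² = Σᵢⱼ Wᵢⱼ²`), its square `54 (det W)² ≤ (|W|²)³`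
   (`GurskyLeBrun.det_sq_le`), the eigenvalue form `54 (abc)² ≤ (a² + b² + c²)³` for `a + b + c = 0`
   (`GurskyLeBrun.fiftyFour_mul_sq_le_cube` — the discriminant `(a-b)²(2a+b)²(a+2b)² ≥ 0` of the
   characteristic polynomial), and sharpness (`GurskyLeBrun.det_le_normSq_mul_sqrt_sharp`:
   equality for `diag(2, -1, -1)`). The reduction to eigenvalues is Mathlib's spectral theorem for
   Hermitian matrices (`det = ∏ λᵢ`, `tr = Σ λᵢ`, `tr W² = Σ λᵢ²`).
2. **The final arithmetic of Theorem 1** (`GurskyLeBrun.sq_mul_le_of_yamabe_chain`): from Obata's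
   inequality `∫s dμ/√V ≤ ∫ŝ dμ̂/√V̂`, Lemma 4 `∫ŝ dμ̂ ≤ 2√6 ∫|Ŵ⁺| dμ̂`, Cauchy–Schwarz
   `∫|Ŵ⁺| dμ̂ ≤ √(∫|Ŵ⁺|²dμ̂) √V̂` and conformal invariance `∫|Ŵ⁺|² dμ̂ = ∫|W⁺|² dμ`, for constant
   `s`: `s² V ≤ 24 ∫|W⁺|² dμ` — as printed, p. 322.
3. **The reduction of the fact to its two global inputs**
   (`gursky_einstein_homotopySphere_four_of_chernGaussBonnet_of_weylGap`), both written
   orientation-free over the tree's Weyl energy `g.weylEnergy = ∫_M |W|² dV` in the `(0,4)`-norm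
   (`WeylEnergy.lean`; `|W|²_{(0,4)} = 4(|W⁺|² + |W⁻|²)`, Chang–Gursky–Yang 2003, Remark 2, proved
   frame-wise in `ChangGurskyYangWeylBudget.lean`) and the Riemannian measure of `Volume.lean`:
   (i) CHERN–GAUSS–BONNET for an Einstein metric `Ric = λ g` on `M ≃ₕ S⁴` ((gb) with `χ = 2`,
   `r̊ = 0`, `s = 4λ`): `∫|W|² dV + (8λ²/3) vol = 64π²`; (ii) the WEYL GAP ((sig) with `τ = 0`, so
   `∫|W⁺|² = ∫|W⁻|²`, and Theorem 1 for the orientation in which `W⁺ ≢ 0`): if some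
   orthonormal-frame component of `W` is nonzero somewhere, `∫|W|² dV = 8∫|W⁺|² ≥ (16λ²/3) vol`.
   Then `8λ² vol ≤ 64π²`. Both inputs are HYPOTHESES of the reduction (binders), not named facts
   (D-0026); discharging them discharges the fact. They are deep and absent from the tree
   (no Chern–Weil theory, Euler characteristic or signature theorem for curvature integrals, no
   Yamabe/Obata theorem, no Weitzenböck formula for `W⁺`).
4. **The numerology of Lemma 4** as real arithmetic at a point: `GurskyLeBrun.diamond_nonpos`
   (Weitzenböck (1.3) + Kato (kato) + `3√6 det W⁺ ≤ |W⁺|³` + the chain rule for `u₀ = |W⁺|^{1/3}`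
   give `◇u₀ ≤ 0`, (1.4a)) and `GurskyLeBrun.cutoff_pointwise` (the cut-off `u_ε = f_ε ∘ u₀`:
   `u_ε ◇u_ε ≤ ε² max(𝔖, 0)` pointwise from convexity of `f_ε`).
5. **The model case** (`roundSphere_four_gursky_hypotheses`, `roundSphere_four_gursky_conclusion`):
   the round `S⁴` is Riemannian and Einstein with `Ric = 3g` and all orthonormal-frame components
   of its Weyl tensor vanish — the hypotheses of the fact and its first alternative, with the
   tree's definitions (`ricci_roundMetric_holds`, `hasConstantSectionalCurvatureWith_roundMetric`,
   `HasConstantSectionalCurvatureWith.weylFrame_eq_zero`).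

6. **The ORIENTED reduction** (`gursky_einstein_homotopySphere_four_of_oriented`): with an
   orientation `o` (`SmoothOrientation`, which exists since `M ≃ₕ S⁴` is simply connected,
   `isOrientable_of_simplyConnectedSpace_holds`) the chiral norms `|W^±|²` are read frame-wise as
   `¼‖A − (tr A/3)1‖²`, `¼‖C − (tr C/3)1‖²` in positively oriented orthonormal frames (which exist,
   `exists_isOrthonormalFrame_isPosFrame` of `SelfDualMetricFrameProofs.lean`), and the fact follows from FOUR hypotheses each of which
   is one printed statement: Gursky–LeBrun Thm. 1 (`W⁺ ≢ 0 ⟹ ∫|W⁺|² ≥ ∫s²/24`), its Cor. 1 (i)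
   (mirror), the signature formula with `τ = 0` (`∫|W⁺|² = ∫|W⁻|²`) and Chern–Gauss–Bonnet with
   `χ = 2` (`∫|W⁺|² + ∫|W⁻|² + (2λ²/3)vol = 16π²`).

The conformal-Laplacian law `S(u²G) = u⁻³(S u − 6Δu)` in dimension four (the scalar part of
`𝔖_{u²g} = u⁻³◇u`) is `MetricCoord.IsMetricOn.scalAt_conformal_sq_four`
(`Lorentzian/ConformalCoordCurvatureSq.lean`); `dμ_{u²g} = u⁴ dμ_g` is
`riemannianMeasure_eq_withDensity_of_conformal_sq_four` (`Lorentzian/ConformalVolume.lean`); the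
cut-off `f_ε` exists by `Literature.Analysis.Calculus.exists_smooth_convex_cutoff`; Einstein metric
components have harmonic curvature by `MetricCoord.IsMetricOn.sum_coord_covRiemAt_first_eq_zero_of_einstein`
(`Lorentzian/CoordHarmonicCurvature.lean`).

## References

* [Gursky2000] M. J. Gursky, Math. Ann. 318 (2000) 417–431, Thm. 1 (not held; acquisition wanted).
* [GurskyLebrun1999] M. J. Gursky, C. LeBrun, Ann. Global Anal. Geom. 17 (1999) 315–328,
  arXiv:math/9807055, §2 (gb)–(sig), §3 Lemma 4, Thm. 1, Cor. 1, §5.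
* [Besse1987] A. L. Besse, Einstein Manifolds, 6.31–6.35, 16.24.
* [ChangGurskyYang2003] S.-Y. A. Chang, M. J. Gursky, P. C. Yang, Publ. Math. IHÉS 98 (2003), Remark 2.
-/

noncomputable section

open MeasureTheory Finset Matrix
open scoped Manifold ContDiff ENNReal ContinuousMap

namespace Literature.Geometry.Riemannian

open Literature.Geometry.Lorentzian (PseudoRiemannianMetric riemannianMeasure)
open Literature.Geometry.Lorentzian.PseudoRiemannianMetric

namespace GurskyLeBrun

/-! ### 1. The sharp algebraic inequality `3√6 det W⁺ ≤ |W⁺|³` -/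

/-- **Eigenvalue form**: for real `a, b, c` with `a + b + c = 0`,
`54 (abc)² ≤ (a² + b² + c²)³`; the difference is twice the discriminant
`(a-b)²(b-c)²(c-a)² = (a-b)²(2a+b)²(a+2b)²` of `t³ - ½(a²+b²+c²) t - abc`.
[cite: GurskyLebrun1999, §3, proof of Lemma 4] -/
theorem fiftyFour_mul_sq_le_cube {a b c : ℝ} (h : a + b + c = 0) :
    54 * (a * b * c) ^ 2 ≤ (a ^ 2 + b ^ 2 + c ^ 2) ^ 3 := by
  have hc : c = -a - b := by linarith
  subst hc
  nlinarith [sq_nonneg ((a - b) * (2 * a + b) * (a + 2 * b))]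

/-- **Eigenvalue form, signed**: for real `a, b, c` with `a + b + c = 0`,
`3√6 · abc ≤ (a² + b² + c²) √(a² + b² + c²)`. [cite: GurskyLebrun1999, §3, proof of Lemma 4] -/
theorem three_mul_sqrt_six_mul_le {a b c : ℝ} (h : a + b + c = 0) :
    3 * Real.sqrt 6 * (a * b * c) ≤
      (a ^ 2 + b ^ 2 + c ^ 2) * Real.sqrt (a ^ 2 + b ^ 2 + c ^ 2) := by
  set p := a ^ 2 + b ^ 2 + c ^ 2 with hp_def
  have hp : 0 ≤ p := by positivity
  have e1 : (3 * Real.sqrt 6 * (a * b * c)) ^ 2 = 54 * (a * b * c) ^ 2 := by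
    rw [mul_pow, mul_pow, Real.sq_sqrt (by norm_num : (0 : ℝ) ≤ 6)]
    ring
  have e2 : (p * Real.sqrt p) ^ 2 = p ^ 3 := by
    rw [mul_pow, Real.sq_sqrt hp]
    ring
  have hsq : (3 * Real.sqrt 6 * (a * b * c)) ^ 2 ≤ (p * Real.sqrt p) ^ 2 := by
    rw [e1, e2]
    exact fiftyFour_mul_sq_le_cube h
  calc 3 * Real.sqrt 6 * (a * b * c) ≤ |3 * Real.sqrt 6 * (a * b * c)| := le_abs_self _
    _ ≤ |p * Real.sqrt p| := sq_le_sq.mp hsq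
    _ = p * Real.sqrt p := abs_of_nonneg (by positivity)

/-- A real symmetric matrix is Hermitian (trivial star). [folklore] -/
theorem isHermitian_of_isSymm {n : Type*} {W : Matrix n n ℝ} (hW : W.IsSymm) : W.IsHermitian := by
  rw [Matrix.IsHermitian, conjTranspose_eq_transpose_of_trivial]
  exact hW

/-- For a real symmetric matrix, `Σᵢⱼ Wᵢⱼ² = Σᵢ λᵢ²` (Frobenius norm through the spectral
theorem: `Σᵢⱼ Wᵢⱼ² = tr W² = Σ λᵢ²`). [folklore] -/
theorem sum_sq_eq_sum_eigenvalues_sq {n : Type*} [Fintype n] [DecidableEq n] {W : Matrix n n ℝ}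
    (hW : W.IsSymm) :
    ∑ i, ∑ j, W i j ^ 2 = ∑ i, (isHermitian_of_isSymm hW).eigenvalues i ^ 2 := by
  rw [← Literature.LinearAlgebra.Matrix.trace_pow_eq_sum (isHermitian_of_isSymm hW) 2, pow_two,
    Matrix.trace]
  simp only [Matrix.diag, Matrix.mul_apply]
  refine sum_congr rfl fun i _ => sum_congr rfl fun j _ => ?_
  have hsymm : W j i = W i j := by
    have h := congrFun (congrFun hW i) j
    simpa [transpose_apply] using h
  rw [hsymm, pow_two]

/-- **The sharp algebraic inequality `3√6 det W⁺ ≤ |W⁺|³`** (Gursky–LeBrun 1999, proof of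
Lemma 4: "the (sharp) algebraic inequality `3√6 det W⁺ ≤ |W⁺|³`"; Gursky 2000), for a real
symmetric trace-free `3 × 3` matrix `W` — the matrix of the trace-free symmetric endomorphism
`W⁺_x` of the Euclidean `3`-space `Λ⁺_x` in an orthonormal basis — with `|W|² = Σᵢⱼ Wᵢⱼ²`
(`= Σ λᵢ²`, the norm of (gb)) and `|W|³ = |W|² √|W|²`. Proof: `det W = λ₁λ₂λ₃`, `Σ λᵢ = tr W = 0`
(spectral theorem) and `fiftyFour_mul_sq_le_cube`.
[cite: GurskyLebrun1999, §3, proof of Lemma 4] [cite: Gursky2000, Theorem 1 (proof)] -/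
theorem det_le_normSq_mul_sqrt (W : Matrix (Fin 3) (Fin 3) ℝ) (hW : W.IsSymm)
    (htr : W.trace = 0) :
    3 * Real.sqrt 6 * W.det ≤ (∑ i, ∑ j, W i j ^ 2) * Real.sqrt (∑ i, ∑ j, W i j ^ 2) := by
  have hH : W.IsHermitian := isHermitian_of_isSymm hW
  have hdet : W.det = ∏ i, hH.eigenvalues i := by
    have := hH.det_eq_prod_eigenvalues
    simpa [RCLike.ofReal_real_eq_id] using this
  have htr' : ∑ i, hH.eigenvalues i = 0 := by
    have := hH.trace_eq_sum_eigenvalues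
    simp only [RCLike.ofReal_real_eq_id, id_eq] at this
    rw [← this, htr]
  have hsq : ∑ i, ∑ j, W i j ^ 2 = ∑ i, hH.eigenvalues i ^ 2 := sum_sq_eq_sum_eigenvalues_sq hW
  rw [hdet, hsq]
  simp only [Fin.sum_univ_three, Fin.prod_univ_three] at htr' ⊢
  exact three_mul_sqrt_six_mul_le htr'

/-- **Squared form**: `54 (det W)² ≤ (Σᵢⱼ Wᵢⱼ²)³` for a real symmetric trace-free `3 × 3`
matrix (equivalently: the characteristic polynomial `t³ - ½|W|² t - det W` has nonnegative
discriminant). [cite: GurskyLebrun1999, §3, proof of Lemma 4] -/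
theorem det_sq_le (W : Matrix (Fin 3) (Fin 3) ℝ) (hW : W.IsSymm) (htr : W.trace = 0) :
    54 * W.det ^ 2 ≤ (∑ i, ∑ j, W i j ^ 2) ^ 3 := by
  have hH : W.IsHermitian := isHermitian_of_isSymm hW
  have hdet : W.det = ∏ i, hH.eigenvalues i := by
    have := hH.det_eq_prod_eigenvalues
    simpa [RCLike.ofReal_real_eq_id] using this
  have htr' : ∑ i, hH.eigenvalues i = 0 := by
    have := hH.trace_eq_sum_eigenvalues
    simp only [RCLike.ofReal_real_eq_id, id_eq] at this
    rw [← this, htr]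
  have hsq : ∑ i, ∑ j, W i j ^ 2 = ∑ i, hH.eigenvalues i ^ 2 := sum_sq_eq_sum_eigenvalues_sq hW
  rw [hdet, hsq]
  simp only [Fin.sum_univ_three, Fin.prod_univ_three] at htr' ⊢
  exact fiftyFour_mul_sq_le_cube htr'

/-- **Sharpness** of `3√6 det W ≤ |W|³`: equality holds for the trace-free symmetric matrix
`diag(2, -1, -1)` (`det = 2`, `|W|² = 6`), the eigenvalue pattern of `W⁺` with "at most `2` distinct
eigenvalues" of the equality discussion in Gursky–LeBrun 1999, proof of Lemma 4.
[cite: GurskyLebrun1999, §3, proof of Lemma 4] -/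
theorem det_le_normSq_mul_sqrt_sharp :
    ∃ W : Matrix (Fin 3) (Fin 3) ℝ, W.IsSymm ∧ W.trace = 0 ∧ W ≠ 0 ∧
      3 * Real.sqrt 6 * W.det = (∑ i, ∑ j, W i j ^ 2) * Real.sqrt (∑ i, ∑ j, W i j ^ 2) := by
  refine ⟨Matrix.diagonal ![2, -1, -1], Matrix.diagonal_transpose _, ?_, ?_, ?_⟩
  · simp [Matrix.trace, Fin.sum_univ_three]
    norm_num
  · intro h
    have := congrFun (congrFun h 0) 0
    simp at this
  · have v2 : (![(2 : ℝ), -1, -1]) 2 = -1 := rfl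
    have hdet : (Matrix.diagonal ![(2 : ℝ), -1, -1]).det = 2 := by
      norm_num [Matrix.det_diagonal, Fin.prod_univ_three, v2]
    have hsq : ∑ i, ∑ j, (Matrix.diagonal ![(2 : ℝ), -1, -1]) i j ^ 2 = 6 := by
      norm_num [Fin.sum_univ_three, Matrix.diagonal, v2]
    rw [hdet, hsq]
    have h6 : Real.sqrt 6 * Real.sqrt 6 = 6 := Real.mul_self_sqrt (by norm_num)
    nlinarith [h6, Real.sqrt_nonneg 6]

/-- **Scaled trace-free parts**: for a real symmetric `3 × 3` matrix `A` and `c ∈ ℝ`, the matrix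
`c (A - (tr A/3) 1)` is symmetric and trace-free, so `3√6 det ≤ |·|² √|·|²` applies to it. With
`c = ½` and `A` Hamilton's block `(R(φᵢ, φⱼ))` of a positive orthonormal frame this is `W⁺`
(`W⁺ = ½(A - (tr A/3)1)` in the orthonormal basis `φᵢ/√2` of `Λ⁺`; Hamilton 1997, §1.2;
`ChangGurskyYangWeylBudget.lean`). [cite: GurskyLebrun1999, §3, proof of Lemma 4] -/
theorem det_smul_traceFree_le (A : Matrix (Fin 3) (Fin 3) ℝ) (hA : A.IsSymm) (c : ℝ) :
    3 * Real.sqrt 6 * (c • (A - (A.trace / 3) • (1 : Matrix (Fin 3) (Fin 3) ℝ))).det ≤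
      (∑ i, ∑ j, (c • (A - (A.trace / 3) • (1 : Matrix (Fin 3) (Fin 3) ℝ))) i j ^ 2) *
        Real.sqrt (∑ i, ∑ j, (c • (A - (A.trace / 3) • (1 : Matrix (Fin 3) (Fin 3) ℝ))) i j ^ 2) := by
  apply det_le_normSq_mul_sqrt
  · have hAt : Aᵀ = A := hA
    change (c • (A - (A.trace / 3) • (1 : Matrix (Fin 3) (Fin 3) ℝ)))ᵀ = _
    rw [transpose_smul, transpose_sub, transpose_smul, transpose_one, hAt]
  · rw [trace_smul, trace_sub, trace_smul, trace_one, Fintype.card_fin]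
    simp only [Nat.cast_ofNat, smul_eq_mul]
    ring

section HamiltonBlocks

variable {E : Type*} [NormedAddCommGroup E] [NormedSpace ℝ E] {H : Type*} [TopologicalSpace H]
  {I : ModelWithCorners ℝ E H} {M : Type*} [TopologicalSpace M] [ChartedSpace H M]
  [IsManifold I ∞ M] {n : ℕ∞ω} [FiniteDimensional ℝ E] [CompleteSpace E]
  {g : PseudoRiemannianMetric I n E (TangentSpace I : M → Type _)}
  {cov : CovariantDerivative I E (TangentSpace I : M → Type _)}

/-- **`3√6 det W⁺ ≤ |W⁺|³` for the curvature of a Levi-Civita connection**, frame-wise: in any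
`4`-frame `e` at `x`, Hamilton's block `A = (R(φᵢ, φⱼ))` of the curvature of a Levi-Civita
connection `cov` of a `C²` metric `g` is symmetric (`blockA_isSymm`), so the `W⁺`-matrix
`½(A - (tr A/3)1)` (the matrix of `W⁺_x` on `Λ⁺_x` when `e` is a positive `g_x`-orthonormal frame)
obeys the sharp inequality of Gursky–LeBrun 1999, proof of Lemma 4.
[cite: GurskyLebrun1999, §3, proof of Lemma 4] [cite: Hamilton1997, §1.2] -/
theorem three_sqrt_six_det_weylPlusBlock_le (h : g.IsLeviCivita cov) (hn : 2 ≤ n) (x : M)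
    (e : Fin 4 → TangentSpace I x) :
    3 * Real.sqrt 6 *
        ((1 / 2 : ℝ) • (g.blockA cov x e -
          ((g.blockA cov x e).trace / 3) • (1 : Matrix (Fin 3) (Fin 3) ℝ))).det ≤
      (∑ i, ∑ j, ((1 / 2 : ℝ) • (g.blockA cov x e -
          ((g.blockA cov x e).trace / 3) • (1 : Matrix (Fin 3) (Fin 3) ℝ))) i j ^ 2) *
        Real.sqrt (∑ i, ∑ j, ((1 / 2 : ℝ) • (g.blockA cov x e -
          ((g.blockA cov x e).trace / 3) • (1 : Matrix (Fin 3) (Fin 3) ℝ))) i j ^ 2) :=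
  det_smul_traceFree_le _ (blockA_isSymm h hn x e) _

/-- **`3√6 det W⁻ ≤ |W⁻|³`** ("reading this in the mirror", Gursky–LeBrun 1999, Cor. 1): the same
for Hamilton's block `C = (R(ψᵢ, ψⱼ))` (`W⁻ = ½(C - (tr C/3)1)`), symmetric by `blockC_isSymm`.
[cite: GurskyLebrun1999, §3, Cor. 1] [cite: Hamilton1997, §1.2] -/
theorem three_sqrt_six_det_weylMinusBlock_le (h : g.IsLeviCivita cov) (hn : 2 ≤ n) (x : M)
    (e : Fin 4 → TangentSpace I x) :
    3 * Real.sqrt 6 *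
        ((1 / 2 : ℝ) • (g.blockC cov x e -
          ((g.blockC cov x e).trace / 3) • (1 : Matrix (Fin 3) (Fin 3) ℝ))).det ≤
      (∑ i, ∑ j, ((1 / 2 : ℝ) • (g.blockC cov x e -
          ((g.blockC cov x e).trace / 3) • (1 : Matrix (Fin 3) (Fin 3) ℝ))) i j ^ 2) *
        Real.sqrt (∑ i, ∑ j, ((1 / 2 : ℝ) • (g.blockC cov x e -
          ((g.blockC cov x e).trace / 3) • (1 : Matrix (Fin 3) (Fin 3) ℝ))) i j ^ 2) :=
  det_smul_traceFree_le _ (blockC_isSymm h hn x e) _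

/-- The Levi-Civita connection `g.leviCivita` of `LeviCivita.lean` is a Levi-Civita connection
(`isLeviCivita_leviCivita_holds`), so the two block inequalities hold for `g.blockA g.leviCivita`,
`g.blockC g.leviCivita` of a `C²` metric. [cite: GurskyLebrun1999, §3, proof of Lemma 4] -/
theorem three_sqrt_six_det_weylPlusBlock_leviCivita_le [Fact (1 ≤ n)] [g.HasLeviCivita]
    (hn : 2 ≤ n) (x : M) (e : Fin 4 → TangentSpace I x) :
    3 * Real.sqrt 6 *
        ((1 / 2 : ℝ) • (g.blockA g.leviCivita x e -
          ((g.blockA g.leviCivita x e).trace / 3) • (1 : Matrix (Fin 3) (Fin 3) ℝ))).det ≤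
      (∑ i, ∑ j, ((1 / 2 : ℝ) • (g.blockA g.leviCivita x e -
          ((g.blockA g.leviCivita x e).trace / 3) • (1 : Matrix (Fin 3) (Fin 3) ℝ))) i j ^ 2) *
        Real.sqrt (∑ i, ∑ j, ((1 / 2 : ℝ) • (g.blockA g.leviCivita x e -
          ((g.blockA g.leviCivita x e).trace / 3) • (1 : Matrix (Fin 3) (Fin 3) ℝ))) i j ^ 2) :=
  three_sqrt_six_det_weylPlusBlock_le g.isLeviCivita_leviCivita_holds hn x e

end HamiltonBlocks

/-! ### 2. The arithmetic of Theorem 1: Obata + Lemma 4 + Cauchy–Schwarz + conformal invariance -/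

/-- **The chain of inequalities proving Theorem 1** (Gursky–LeBrun 1999, p. 322, for an Einstein
metric `g` with constant scalar curvature `s` and volume `V > 0`, and the conformal metric
`ĝ = u²g` of Lemma 4 with volume `V̂ > 0`): from OBATA's inequality `s V/√V ≤ A/√V̂`
(`A = ∫ s_ĝ dμ_ĝ`; "any Einstein metric is a Yamabe minimizer"), LEMMA 4 `A ≤ 2√6 P`
(`P = ∫|W⁺_ĝ| dμ_ĝ`), CAUCHY–SCHWARZ `P ≤ √Q √V̂` (`Q = ∫|W⁺_ĝ|² dμ_ĝ`) and the conformal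
invariance `Q = ∫|W⁺_g|² dμ_g`, one gets, for `s ≥ 0`, `s² V ≤ 24 Q`, i.e. `∫|W⁺|² dμ ≥ ∫ s²/24 dμ`. Pure real
arithmetic; the four inputs are the hypotheses. [cite: GurskyLebrun1999, §3, Theorem 1 (proof)] -/
theorem sq_mul_le_of_yamabe_chain {s V Vhat A P Q : ℝ} (hs : 0 ≤ s) (hV : 0 < V)
    (hVhat : 0 < Vhat) (hQ : 0 ≤ Q) (hObata : s * V / Real.sqrt V ≤ A / Real.sqrt Vhat)
    (hLemma4 : A ≤ 2 * Real.sqrt 6 * P) (hCS : P ≤ Real.sqrt Q * Real.sqrt Vhat) :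
    s ^ 2 * V ≤ 24 * Q := by
  have hsV : 0 < Real.sqrt V := Real.sqrt_pos.2 hV
  have hsVh : 0 < Real.sqrt Vhat := Real.sqrt_pos.2 hVhat
  -- `s √V = s V/√V ≤ A/√V̂ ≤ 2√6 P/√V̂ ≤ 2√6 √Q`
  have h1 : s * V / Real.sqrt V = s * Real.sqrt V := by
    rw [div_eq_iff hsV.ne', mul_assoc, Real.mul_self_sqrt hV.le]
  have h2 : A / Real.sqrt Vhat ≤ 2 * Real.sqrt 6 * Real.sqrt Q := by
    rw [div_le_iff₀ hsVh]
    calc A ≤ 2 * Real.sqrt 6 * P := hLemma4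
      _ ≤ 2 * Real.sqrt 6 * (Real.sqrt Q * Real.sqrt Vhat) :=
          mul_le_mul_of_nonneg_left hCS (by positivity)
      _ = 2 * Real.sqrt 6 * Real.sqrt Q * Real.sqrt Vhat := by ring
  have h3 : s * Real.sqrt V ≤ 2 * Real.sqrt 6 * Real.sqrt Q := by
    rw [← h1]; exact hObata.trans h2
  have h4 : (s * Real.sqrt V) ^ 2 ≤ (2 * Real.sqrt 6 * Real.sqrt Q) ^ 2 :=
    pow_le_pow_left₀ (by positivity) h3 2
  calc s ^ 2 * V = (s * Real.sqrt V) ^ 2 := by rw [mul_pow, Real.sq_sqrt hV.le]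
    _ ≤ (2 * Real.sqrt 6 * Real.sqrt Q) ^ 2 := h4
    _ = 24 * Q := by
        rw [mul_pow, mul_pow, Real.sq_sqrt hQ, Real.sq_sqrt (by norm_num : (0 : ℝ) ≤ 6)]
        ring

end GurskyLeBrun

/-! ### 3. The fact from Chern–Gauss–Bonnet and the Weyl gap (orientation-free forms) -/

/-- **Reduction of `gursky_einstein_homotopySphere_four` to its two global curvature inputs**, both
hypotheses here (D-0026: binders, not named facts), stated orientation-free over the Weyl energy
`g.weylEnergy = ∫_M |W_g|² dV_g` of `WeylEnergy.lean` (`(0,4)`-norm, `= 4(|W⁺|² + |W⁻|²)` in the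
`End(Λ²)`-norms of Gursky–LeBrun, Chang–Gursky–Yang 2003, Remark 2) and the Riemannian measure of
`Volume.lean`, for every smooth Riemannian Einstein metric `Ric = λ g` (with its Levi-Civita
connection) on a closed smooth `4`-manifold `M ≃ₕ S⁴`:
* `hCGB` — CHERN–GAUSS–BONNET (Gursky–LeBrun 1999, (gb): `8π²χ = ∫[|W₊|² + |W₋|² + s²/24 - |r̊|²/2]dμ`;
  Besse 1987, 6.31–6.32) with `χ(M) = χ(S⁴) = 2`, `r̊ = 0`, `s = 4λ`:
  `∫|W|² dV + (8λ²/3) vol(M,g) = 64π²`;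
* `hGap` — THE WEYL GAP: Gursky's Theorem 1 (Gursky 2000; Gursky–LeBrun 1999, Thm. 1: compact
  oriented Einstein, `s > 0`, `W⁺ ≢ 0` ⟹ `∫|W⁺|² dμ ≥ ∫ s²/24 dμ`) combined with the signature
  formula (ibid. (sig); Besse 6.34) and `τ(M) = 0`, `M` simply connected hence orientable: if some
  orthonormal-frame component `W_{ijkl}` of the Weyl tensor (`weylFrame`) is nonzero at some point,
  then (orienting `M` so that `W⁺ ≢ 0`, `∫|W⁻|² = ∫|W⁺|²`) `∫|W|² dV = 8∫|W⁺|² ≥ (16λ²/3) vol(M,g)`.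
Conclusion as printed in §5 of Gursky–LeBrun 1999 / the corollary of Gursky 2000, Thm. 1: `W ≡ 0`
in all orthonormal frames, or `(16λ²/3 + 8λ²/3) vol ≤ 64π²`, i.e. `vol(M,g) ≤ 8π²/λ²`.
[cite: Gursky2000, Theorem 1] [cite: GurskyLebrun1999, §2 (gb)–(sig), §3 Thm. 1, §5] -/
theorem gursky_einstein_homotopySphere_four_of_chernGaussBonnet_of_weylGap
    (hCGB : ∀ (M : Type) [TopologicalSpace M] [T2Space M] [SecondCountableTopology M]
      [ChartedSpace (EuclideanSpace ℝ (Fin 4)) M] [IsManifold (𝓡 4) ∞ M] [CompactSpace M]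
      [T3Space M] [MeasurableSpace M] [BorelSpace M],
      M ≃ₕ Metric.sphere (0 : EuclideanSpace ℝ (Fin 5)) 1 →
      ∀ (g : PseudoRiemannianMetric (𝓡 4) ∞ (EuclideanSpace ℝ (Fin 4))
          (TangentSpace (𝓡 4) : M → Type _))
        [g.HasLeviCivita] (hg : g.IsRiemannian) (lam : ℝ), 0 < lam →
        (∀ (x : M) (X Y : TangentSpace (𝓡 4) x), g.ricci x X Y = lam * g.val x X Y) →
        g.weylEnergy + ENNReal.ofReal (8 * lam ^ 2 / 3) *
            riemannianMeasure (g.toContMDiffRiemannianMetric hg) Set.univ =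
          ENNReal.ofReal (64 * Real.pi ^ 2))
    (hGap : ∀ (M : Type) [TopologicalSpace M] [T2Space M] [SecondCountableTopology M]
      [ChartedSpace (EuclideanSpace ℝ (Fin 4)) M] [IsManifold (𝓡 4) ∞ M] [CompactSpace M]
      [T3Space M] [MeasurableSpace M] [BorelSpace M],
      M ≃ₕ Metric.sphere (0 : EuclideanSpace ℝ (Fin 5)) 1 →
      ∀ (g : PseudoRiemannianMetric (𝓡 4) ∞ (EuclideanSpace ℝ (Fin 4))
          (TangentSpace (𝓡 4) : M → Type _))
        [g.HasLeviCivita] (hg : g.IsRiemannian) (lam : ℝ), 0 < lam →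
        (∀ (x : M) (X Y : TangentSpace (𝓡 4) x), g.ricci x X Y = lam * g.val x X Y) →
        (∃ (x : M) (e : Fin 4 → TangentSpace (𝓡 4) x), g.IsOrthonormalFrame x e ∧
            ∃ i j k l, g.weylFrame x e i j k l ≠ 0) →
        ENNReal.ofReal (16 * lam ^ 2 / 3) *
            riemannianMeasure (g.toContMDiffRiemannianMetric hg) Set.univ ≤ g.weylEnergy) :
    gursky_einstein_homotopySphere_four := by
  intro M _ _ _ _ _ _ _ _ _ e g _ hg lam hlam hRic
  by_cases hW : ∀ (x : M) (f : Fin 4 → TangentSpace (𝓡 4) x), g.IsOrthonormalFrame x f →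
      ∀ i j k l, g.weylFrame x f i j k l = 0
  · exact Or.inl hW
  right
  push Not at hW
  obtain ⟨x, f, hf, i, j, k, l, hne⟩ := hW
  have h1 := hCGB M e g hg lam hlam hRic
  have h2 := hGap M e g hg lam hlam hRic ⟨x, f, hf, i, j, k, l, hne⟩
  set V := riemannianMeasure (g.toContMDiffRiemannianMetric hg) Set.univ with hV
  have h3 : ENNReal.ofReal (16 * lam ^ 2 / 3) * V + ENNReal.ofReal (8 * lam ^ 2 / 3) * V ≤
      ENNReal.ofReal (64 * Real.pi ^ 2) := by
    calc ENNReal.ofReal (16 * lam ^ 2 / 3) * V + ENNReal.ofReal (8 * lam ^ 2 / 3) * V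
        ≤ g.weylEnergy + ENNReal.ofReal (8 * lam ^ 2 / 3) * V := by gcongr
      _ = ENNReal.ofReal (64 * Real.pi ^ 2) := h1
  rw [← add_mul, ← ENNReal.ofReal_add (by positivity) (by positivity),
    show 16 * lam ^ 2 / 3 + 8 * lam ^ 2 / 3 = 8 * lam ^ 2 by ring] at h3
  have hpos : 0 < 8 * lam ^ 2 := by positivity
  calc V ≤ ENNReal.ofReal (64 * Real.pi ^ 2) / ENNReal.ofReal (8 * lam ^ 2) := by
        rw [ENNReal.le_div_iff_mul_le (Or.inl (ENNReal.ofReal_pos.2 hpos).ne')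
          (Or.inl ENNReal.ofReal_ne_top), mul_comm]
        exact h3
    _ = ENNReal.ofReal (64 * Real.pi ^ 2 / (8 * lam ^ 2)) := (ENNReal.ofReal_div_of_pos hpos).symm
    _ = ENNReal.ofReal (8 * Real.pi ^ 2 / lam ^ 2) := by
        congr 1
        field_simp
        ring

/-! ### 4a. The pointwise inequality `◇u₀ ≤ 0` for `u₀ = |W⁺|^{1/3}`: the numerology of Lemma 4 -/

/-- **`◇u₀ ≤ 0` away from the zeros of `W⁺`** (Gursky–LeBrun 1999, proof of Lemma 4, (1.4a):
"In conjunction with the (sharp) algebraic inequality `3√6 det W⁺ ≤ |W⁺|³`, equations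
(kato)–(1.3) imply that the non-negative function `u₀ = |W⁺|^{1/3}` satisfies `0 ≥ ◇u₀`"), as the
real-arithmetic statement it is at a point where `w = |W⁺|² > 0`. Notation: `Δ` the analysts'
Laplacian `tr ∇d` (the paper's positive Laplacian `d*d` is `−Δ`), `Lw = Δ|W⁺|²`, `Lu = Δu₀`,
`N = |∇W⁺|²`, `P = |d|W⁺|²|²`, `D = det W⁺`, `s` the scalar curvature. Hypotheses, verbatim up to
this dictionary: Derdziński's WEITZENBÖCK FORMULA (1.3) `0 = ½(−Δ)|W⁺|² + |∇W⁺|² + (s/2)|W⁺|² − 18 det W⁺`;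
the KATO INEQUALITY (kato) `|∇W⁺|² ≥ (5/3)|∇|W⁺||²` with `|∇|W⁺||² = |d(w^{1/2})|² = P/(4w)`; the
ALGEBRAIC INEQUALITY `3√6 det W⁺ ≤ |W⁺|³ = w √w` (`det_le_normSq_mul_sqrt`); the CHAIN RULE for
`u₀ = w^{1/6}`, `Δ(w^p) = p w^{p−1} Δw + p(p−1) w^{p−2} |dw|²` (`MetricCoord.lapAt_comp`).
Conclusion: `◇u₀ = 6(−Δ)u₀ + 𝔖 u₀ = −6 Lu + (s − 2√6 |W⁺|) w^{1/6} ≤ 0`. The proof exhibits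
`◇u₀ = (u₀/w)·(−2(N − (5/3)P/(4w)) + 2(18 D − √6 w√w))`, which pins the constants `5/3`, `18`,
`3√6` and the exponent `1/3` to one another. [cite: GurskyLebrun1999, §3, Lemma 4, (kato)–(1.4a)] -/
theorem GurskyLeBrun.diamond_nonpos {w Lw Lu N P D s : ℝ} (hw : 0 < w)
    (hWeitz : 0 = (1 / 2 : ℝ) * (-Lw) + N + s / 2 * w - 18 * D)
    (hKato : (5 / 3 : ℝ) * (P / (4 * w)) ≤ N)
    (hDet : 3 * Real.sqrt 6 * D ≤ w * Real.sqrt w)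
    (hChain : Lu = (1 / 6 : ℝ) * w ^ ((1 / 6 : ℝ) - 1) * Lw +
      (1 / 6 : ℝ) * ((1 / 6 : ℝ) - 1) * w ^ ((1 / 6 : ℝ) - 2) * P) :
    -6 * Lu + (s - 2 * Real.sqrt 6 * Real.sqrt w) * w ^ (1 / 6 : ℝ) ≤ 0 := by
  set r := w ^ (1 / 6 : ℝ) with hr_def
  have hr : 0 < r := Real.rpow_pos_of_pos hw _
  have e1 : w ^ ((1 / 6 : ℝ) - 1) = r / w := by rw [Real.rpow_sub hw, Real.rpow_one]
  have e2 : w ^ ((1 / 6 : ℝ) - 2) = r / w ^ 2 := by rw [Real.rpow_sub hw, Real.rpow_two]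
  rw [e1, e2] at hChain
  have hLw : Lw = 2 * N + s * w - 36 * D := by linarith
  have key : -6 * Lu + (s - 2 * Real.sqrt 6 * Real.sqrt w) * r =
      (r / w) * (-2 * (N - (5 / 3 : ℝ) * (P / (4 * w))) +
        2 * (18 * D - Real.sqrt 6 * (w * Real.sqrt w))) := by
    rw [hChain, hLw]
    field_simp
    ring
  rw [key]
  have h6 : 0 < Real.sqrt 6 := Real.sqrt_pos.2 (by norm_num)
  have hDet' : 18 * D ≤ Real.sqrt 6 * (w * Real.sqrt w) := by
    have h := mul_le_mul_of_nonneg_left hDet h6.le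
    have h66 : Real.sqrt 6 * Real.sqrt 6 = 6 := Real.mul_self_sqrt (by norm_num)
    have h18 : Real.sqrt 6 * (3 * Real.sqrt 6 * D) = 18 * D := by
      rw [show Real.sqrt 6 * (3 * Real.sqrt 6 * D) = 3 * (Real.sqrt 6 * Real.sqrt 6) * D by ring,
        h66]
      ring
    rwa [h18] at h
  exact mul_nonpos_of_nonneg_of_nonpos (div_nonneg hr.le hw.le) (by linarith)

/-- **The cut-off estimate `u_ε ◇u_ε ≤ C ε²`** (Gursky–LeBrun 1999, proof of Lemma 4: with
`u_ε = f_ε ∘ u₀`, `f_ε` smooth, convex, constant on `[0, ε/2]`, `f_ε(x) = x` for `x > ε`,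
"`∫ 𝔖_{g_ε} dμ_{g_ε} = ∫ u_ε ◇u_ε dμ ≤ C ε² Vol(M_ε) + ∫_{M−M_ε} u₀ ◇u₀ dμ`, where `C` is any
positive upper bound for `𝔖_g`"), as the pointwise real-arithmetic statement behind the first
term. At a point, with the analysts' Laplacian `Δ = tr ∇d`: `u₀ ≥ 0` the value of `|W⁺|^{1/3}`,
`Lu₀ = Δu₀`, `P = |du₀|² ≥ 0`, `𝔖` the modified scalar curvature, and for the cut-off
`f0 = f(u₀) ∈ (0, ε]`, `f1 = f'(u₀) ≥ 0`, `f2 = f''(u₀) ≥ 0` (convexity), with the tangent-line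
bound `0 ≤ f(u₀) − u₀ f'(u₀) ≤ ε` (convexity and `f = id` beyond `ε`), the chain rule
`Δu_ε = f1 Δu₀ + f2 P` and `◇u₀ = −6Δu₀ + 𝔖 u₀ ≤ 0` (`diamond_nonpos`; at zeros of `W⁺` take
`f1 = f2 = 0`, `f0 = f(0)`): then `u_ε ◇u_ε = f0 (−6 Δu_ε + 𝔖 f0) ≤ ε² max(𝔖, 0)`.
[cite: GurskyLebrun1999, §3, proof of Lemma 4] -/
theorem GurskyLeBrun.cutoff_pointwise {u₀ Lu₀ Luε P S f0 f1 f2 ε : ℝ}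
    (hP : 0 ≤ P) (hf0 : 0 < f0) (hf0ε : f0 ≤ ε) (hf1 : 0 ≤ f1) (hf2 : 0 ≤ f2)
    (htan : 0 ≤ f0 - u₀ * f1) (htanε : f0 - u₀ * f1 ≤ ε)
    (hChain : Luε = f1 * Lu₀ + f2 * P) (hdiam : -6 * Lu₀ + S * u₀ ≤ 0) :
    f0 * (-6 * Luε + S * f0) ≤ ε ^ 2 * max S 0 := by
  have hS : S ≤ max S 0 := le_max_left _ _
  have hM : 0 ≤ max S 0 := le_max_right _ _
  -- `−6Δu_ε + 𝔖 f0 ≤ f1 ◇u₀ + 𝔖 (f0 − u₀ f1) ≤ max(𝔖,0) ε`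
  have h1 : -6 * Luε + S * f0 ≤ max S 0 * ε := by
    have hA : -6 * Luε + S * f0 ≤ f1 * (-6 * Lu₀ + S * u₀) + S * (f0 - u₀ * f1) := by
      rw [hChain]
      nlinarith [mul_nonneg hf2 hP]
    have hB : f1 * (-6 * Lu₀ + S * u₀) ≤ 0 := mul_nonpos_of_nonneg_of_nonpos hf1 hdiam
    have hC : S * (f0 - u₀ * f1) ≤ max S 0 * ε := by
      calc S * (f0 - u₀ * f1) ≤ max S 0 * (f0 - u₀ * f1) := mul_le_mul_of_nonneg_right hS htan
        _ ≤ max S 0 * ε := mul_le_mul_of_nonneg_left htanε hM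
    linarith
  calc f0 * (-6 * Luε + S * f0) ≤ f0 * (max S 0 * ε) := mul_le_mul_of_nonneg_left h1 hf0.le
    _ ≤ ε * (max S 0 * ε) := mul_le_mul_of_nonneg_right hf0ε (mul_nonneg hM (hf0.le.trans hf0ε))
    _ = ε ^ 2 * max S 0 := by ring

/-! ### 4b. The model case: the round `S⁴` (`Ric = 3g`, `W ≡ 0` — the first alternative) -/

section RoundSphere

open Metric Module

/-- **The round `S⁴` satisfies the hypotheses of `gursky_einstein_homotopySphere_four` and its
first alternative** (non-vacuity of the vended statement with the tree's definitions; Gursky–LeBrun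
1999, §1: `S⁴ = SO(5)/SO(4)` is Einstein, and §5: the round metric `g₁` is the extremal case
excluded from the gap): on the unit sphere of a `5`-dimensional inner product space (for
`V = ℝ⁵` literally the `S⁴` of the fact, with `M ≃ₕ S⁴` the identity) the round metric is
Riemannian, Einstein with `Ric = 3 g` (`ricci_roundMetric_holds`: `Ric = (n-1) g`), and ALL
orthonormal-frame components of its Weyl tensor vanish (constant sectional curvature `1`,
`hasConstantSectionalCurvatureWith_roundMetric`, and `W = 0` for constant curvature, Besse 1987,
1.118–1.119, `HasConstantSectionalCurvatureWith.weylFrame_eq_zero`).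
[cite: GurskyLebrun1999, §1 and §5] [cite: Besse1987, 1.118] -/
theorem roundSphere_four_gursky_hypotheses (V : Type*) [NormedAddCommGroup V]
    [InnerProductSpace ℝ V] [Fact (finrank ℝ V = 4 + 1)] [(roundMetric (n := 4) V).HasLeviCivita] :
    (roundMetric (n := 4) V).IsRiemannian ∧
      (∀ (y : sphere (0 : V) 1) (v w : TangentSpace (𝓡 4) y),
        (roundMetric (n := 4) V).ricci y v w = 3 * (roundMetric (n := 4) V).val y v w) ∧
      ∀ (y : sphere (0 : V) 1) (e : Fin 4 → TangentSpace (𝓡 4) y),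
        (roundMetric (n := 4) V).IsOrthonormalFrame y e →
          ∀ i j k l, (roundMetric (n := 4) V).weylFrame y e i j k l = 0 := by
  refine ⟨isRiemannian_roundMetric, fun y v w ↦ ?_, fun y e he i j k l ↦ ?_⟩
  · have h := ricci_roundMetric_holds V 4 (roundMetric (n := 4) V).leviCivita
      (roundMetric (n := 4) V).isLeviCivita_leviCivita_holds y v w
    rw [ricci_apply, h]
    norm_num
  · have hK := hasConstantSectionalCurvatureWith_roundMetric V
      (roundMetric (n := 4) V).isLeviCivita_leviCivita_holds
    have hι : Fintype.card (Fin 4) = finrank ℝ (EuclideanSpace ℝ (Fin 4)) := by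
      rw [Fintype.card_fin, finrank_euclideanSpace_fin]
    have hb : (roundMetric (n := 4) V).IsOrthonormalFrame y ⇑(he.toBasis hι) := by
      rw [he.coe_toBasis hι]; exact he
    have h0 := hK.weylFrame_eq_zero (he.toBasis hι) hb (by simp) i j k l
    rwa [he.coe_toBasis hι] at h0

/-- Hence the round `S⁴` lies in the FIRST alternative of the fact and the disjunction holds for it
outright (no appeal to the fact): for the round metric with `Ric = 3g`, `λ = 3`, either `W ≡ 0` in
orthonormal frames (true) or `vol ≤ 8π²/9` (not claimed). [cite: GurskyLebrun1999, §5] -/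
theorem roundSphere_four_gursky_conclusion (V : Type*) [NormedAddCommGroup V]
    [InnerProductSpace ℝ V] [Fact (finrank ℝ V = 4 + 1)] [(roundMetric (n := 4) V).HasLeviCivita]
    [MeasurableSpace (sphere (0 : V) 1)] [BorelSpace (sphere (0 : V) 1)] :
    (∀ (y : sphere (0 : V) 1) (e : Fin 4 → TangentSpace (𝓡 4) y),
        (roundMetric (n := 4) V).IsOrthonormalFrame y e →
          ∀ i j k l, (roundMetric (n := 4) V).weylFrame y e i j k l = 0) ∨
      riemannianMeasure ((roundMetric (n := 4) V).toContMDiffRiemannianMetric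
          isRiemannian_roundMetric) Set.univ ≤
        ENNReal.ofReal (8 * Real.pi ^ 2 / 3 ^ 2) :=
  Or.inl (roundSphere_four_gursky_hypotheses V).2.2

end RoundSphere

/-! ### 5. The ORIENTED reduction: Theorem 1, Corollary 1 (i), (gb) with `χ = 2`, (sig) with `τ = 0` -/

section Oriented

open Literature.Topology.FourManifolds (SmoothOrientation IsOrientable
  isOrientable_of_simplyConnectedSpace_holds)

/-- A single squared frame component is bounded by the frame norm `Σ W²`. [folklore] -/
private theorem weylFrame_sq_le_weylNormSqFrame {M : Type*} [TopologicalSpace M]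
    [ChartedSpace (EuclideanSpace ℝ (Fin 4)) M] [IsManifold (𝓡 4) ∞ M]
    (g : PseudoRiemannianMetric (𝓡 4) ∞ (EuclideanSpace ℝ (Fin 4)) (TangentSpace (𝓡 4) : M → Type _))
    [g.HasLeviCivita] (x : M) (f : Fin 4 → TangentSpace (𝓡 4) x) (i j k l : Fin 4) :
    g.weylFrame x f i j k l ^ 2 ≤ g.weylNormSqFrame x f := by
  unfold weylNormSqFrame
  calc g.weylFrame x f i j k l ^ 2
      ≤ ∑ l', g.weylFrame x f i j k l' ^ 2 :=
        Finset.single_le_sum (f := fun l' ↦ g.weylFrame x f i j k l' ^ 2)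
          (fun _ _ ↦ sq_nonneg _) (Finset.mem_univ l)
    _ ≤ ∑ k', ∑ l', g.weylFrame x f i j k' l' ^ 2 :=
        Finset.single_le_sum (f := fun k' ↦ ∑ l', g.weylFrame x f i j k' l' ^ 2)
          (fun _ _ ↦ Finset.sum_nonneg fun _ _ ↦ sq_nonneg _) (Finset.mem_univ k)
    _ ≤ ∑ j', ∑ k', ∑ l', g.weylFrame x f i j' k' l' ^ 2 :=
        Finset.single_le_sum (f := fun j' ↦ ∑ k', ∑ l', g.weylFrame x f i j' k' l' ^ 2)
          (fun _ _ ↦ Finset.sum_nonneg fun _ _ ↦ Finset.sum_nonneg fun _ _ ↦ sq_nonneg _)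
          (Finset.mem_univ j)
    _ ≤ ∑ i', ∑ j', ∑ k', ∑ l', g.weylFrame x f i' j' k' l' ^ 2 :=
        Finset.single_le_sum (f := fun i' ↦ ∑ j', ∑ k', ∑ l', g.weylFrame x f i' j' k' l' ^ 2)
          (fun _ _ ↦ Finset.sum_nonneg fun _ _ ↦ Finset.sum_nonneg fun _ _ ↦
            Finset.sum_nonneg fun _ _ ↦ sq_nonneg _) (Finset.mem_univ i)

/-- **The oriented reduction of `gursky_einstein_homotopySphere_four`.** The chiral Weyl norms are
read frame-wise, without new definitions: given an orientation `o` of `M`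
(`SmoothOrientation`, `Topology/FourManifolds`), a function `w₊ : M → ℝ` (resp. `w₋`) is a
version of `|W⁺|²` (resp. `|W⁻|²`, `End(Λ^±)`-norms of Gursky–LeBrun) if at every point there is a
positively `o`-oriented `g`-orthonormal frame `e` with `w₊(x) = ¼‖A(e) − (tr A(e)/3)1‖²_F` (resp.
`w₋(x) = ¼‖C(e) − (tr C(e)/3)1‖²_F`), `A, C` Hamilton's blocks of the Levi-Civita curvature
(`CurvatureDecomposition.lean`; `W⁺ = ½(A − (tr A/3)1)` on the orthonormal basis `φᵢ/√2` of
`Λ⁺`, Hamilton 1997, §1.2; `W⁻ ≡ 0 ⟺ C` scalar in positive frames is the tree's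
`IsSelfDualWith`, `SelfDualMetric.lean`). For every closed smooth `M ≃ₕ S⁴` and every smooth
Riemannian Einstein metric `Ric = λ g`, `λ > 0` (so `s = 4λ > 0`, `∫ s²/24 dμ = (2λ²/3) vol`), the
four hypotheses are, verbatim up to this dictionary:
* `hThm1` — Gursky–LeBrun 1999, THEOREM 1 (= Gursky 2000, Thm. 1, Einstein case): "compact
  oriented Einstein, `s > 0`, `W⁺ ≢ 0` ⟹ `∫|W⁺|² dμ ≥ ∫ s²/24 dμ`";
* `hCor1` — ibid. COROLLARY 1 (i): the same for `W⁻` ("reading this in the mirror");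
* `hSig` — the HIRZEBRUCH SIGNATURE FORMULA (ibid. (sig): `12π²τ(M) = ∫(|W₊|² − |W₋|²) dμ`;
  Besse 1987, 6.34) together with `τ(M) = 0` for `M ≃ₕ S⁴` (`H²(M) = 0`): `∫|W⁺|² = ∫|W⁻|²`;
* `hGB` — the CHERN–GAUSS–BONNET FORMULA (ibid. (gb):
  `8π²χ(M) = ∫(|W₊|² + |W₋|² + s²/24 − |r̊|²/2) dμ`; Besse 1987, 6.31–6.32) for Einstein `g`
  (`r̊ = 0`) together with `χ(M) = χ(S⁴) = 2`: `∫|W⁺|² + ∫|W⁻|² + (2λ²/3) vol = 16π²`.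
Proof as printed (Gursky–LeBrun 1999, §5; the corollary of Gursky 2000, Thm. 1): `M` is simply
connected, hence orientable (`isOrientable_of_simplyConnectedSpace_holds`); positive orthonormal
frames exist (`exists_isOrthonormalFrame_isPosFrame`, `SelfDualMetricFrameProofs.lean`), which defines `w^±`; if `w⁺ ≢ 0`, Theorem 1 and
(sig) give `(2λ²/3) vol ≤ ∫|W⁺|² = ∫|W⁻|²`, so (gb) gives `3 · (2λ²/3) vol ≤ 16π²`, `vol ≤ 8π²/λ²`;
symmetrically if `w⁻ ≢ 0`; and if `w⁺ ≡ w⁻ ≡ 0` then `Σ W(e)² = ‖A − …‖² + ‖C − …‖² = 0`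
(`weylNormSqFrame_eq_hamiltonBlocks`) in the chosen frames, hence in every orthonormal frame
(`weylNormSqFrame_eq_of_isOrthonormalFrame`), i.e. `W ≡ 0`. [cite: Gursky2000, Theorem 1]
[cite: GurskyLebrun1999, §2 (gb)–(sig), §3 Thm. 1 and Cor. 1, §5] [cite: Besse1987, 6.31–6.34] -/
theorem gursky_einstein_homotopySphere_four_of_oriented
    (hThm1 : ∀ (M : Type) [TopologicalSpace M] [T2Space M] [SecondCountableTopology M]
      [ChartedSpace (EuclideanSpace ℝ (Fin 4)) M] [IsManifold (𝓡 4) ∞ M] [CompactSpace M]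
      [T3Space M] [MeasurableSpace M] [BorelSpace M],
      M ≃ₕ Metric.sphere (0 : EuclideanSpace ℝ (Fin 5)) 1 →
      ∀ (g : PseudoRiemannianMetric (𝓡 4) ∞ (EuclideanSpace ℝ (Fin 4))
          (TangentSpace (𝓡 4) : M → Type _))
        [g.HasLeviCivita] (hg : g.IsRiemannian) (lam : ℝ), 0 < lam →
        (∀ (x : M) (X Y : TangentSpace (𝓡 4) x), g.ricci x X Y = lam * g.val x X Y) →
        ∀ (o : SmoothOrientation (𝓡 4) M) (wp : M → ℝ),
        (∀ x, ∃ e : Fin 4 → TangentSpace (𝓡 4) x, g.IsOrthonormalFrame x e ∧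
          o.IsPosFrame x (frameOfFin e) ∧
          wp x = (1 / 4 : ℝ) * ∑ i : Fin 3, ∑ j : Fin 3,
            ((g.blockA g.leviCivita x e -
              ((g.blockA g.leviCivita x e).trace / 3) • (1 : Matrix (Fin 3) (Fin 3) ℝ)) i j) ^ 2) →
        (∃ x, wp x ≠ 0) →
        ENNReal.ofReal (2 * lam ^ 2 / 3) *
            riemannianMeasure (g.toContMDiffRiemannianMetric hg) Set.univ ≤
          ∫⁻ x, ENNReal.ofReal (wp x) ∂riemannianMeasure (g.toContMDiffRiemannianMetric hg))
    (hCor1 : ∀ (M : Type) [TopologicalSpace M] [T2Space M] [SecondCountableTopology M]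
      [ChartedSpace (EuclideanSpace ℝ (Fin 4)) M] [IsManifold (𝓡 4) ∞ M] [CompactSpace M]
      [T3Space M] [MeasurableSpace M] [BorelSpace M],
      M ≃ₕ Metric.sphere (0 : EuclideanSpace ℝ (Fin 5)) 1 →
      ∀ (g : PseudoRiemannianMetric (𝓡 4) ∞ (EuclideanSpace ℝ (Fin 4))
          (TangentSpace (𝓡 4) : M → Type _))
        [g.HasLeviCivita] (hg : g.IsRiemannian) (lam : ℝ), 0 < lam →
        (∀ (x : M) (X Y : TangentSpace (𝓡 4) x), g.ricci x X Y = lam * g.val x X Y) →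
        ∀ (o : SmoothOrientation (𝓡 4) M) (wm : M → ℝ),
        (∀ x, ∃ e : Fin 4 → TangentSpace (𝓡 4) x, g.IsOrthonormalFrame x e ∧
          o.IsPosFrame x (frameOfFin e) ∧
          wm x = (1 / 4 : ℝ) * ∑ i : Fin 3, ∑ j : Fin 3,
            ((g.blockC g.leviCivita x e -
              ((g.blockC g.leviCivita x e).trace / 3) • (1 : Matrix (Fin 3) (Fin 3) ℝ)) i j) ^ 2) →
        (∃ x, wm x ≠ 0) →
        ENNReal.ofReal (2 * lam ^ 2 / 3) *
            riemannianMeasure (g.toContMDiffRiemannianMetric hg) Set.univ ≤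
          ∫⁻ x, ENNReal.ofReal (wm x) ∂riemannianMeasure (g.toContMDiffRiemannianMetric hg))
    (hSig : ∀ (M : Type) [TopologicalSpace M] [T2Space M] [SecondCountableTopology M]
      [ChartedSpace (EuclideanSpace ℝ (Fin 4)) M] [IsManifold (𝓡 4) ∞ M] [CompactSpace M]
      [T3Space M] [MeasurableSpace M] [BorelSpace M],
      M ≃ₕ Metric.sphere (0 : EuclideanSpace ℝ (Fin 5)) 1 →
      ∀ (g : PseudoRiemannianMetric (𝓡 4) ∞ (EuclideanSpace ℝ (Fin 4))
          (TangentSpace (𝓡 4) : M → Type _))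
        [g.HasLeviCivita] (hg : g.IsRiemannian) (lam : ℝ), 0 < lam →
        (∀ (x : M) (X Y : TangentSpace (𝓡 4) x), g.ricci x X Y = lam * g.val x X Y) →
        ∀ (o : SmoothOrientation (𝓡 4) M) (wp wm : M → ℝ),
        (∀ x, ∃ e : Fin 4 → TangentSpace (𝓡 4) x, g.IsOrthonormalFrame x e ∧
          o.IsPosFrame x (frameOfFin e) ∧
          wp x = (1 / 4 : ℝ) * ∑ i : Fin 3, ∑ j : Fin 3,
            ((g.blockA g.leviCivita x e -
              ((g.blockA g.leviCivita x e).trace / 3) • (1 : Matrix (Fin 3) (Fin 3) ℝ)) i j) ^ 2 ∧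
          wm x = (1 / 4 : ℝ) * ∑ i : Fin 3, ∑ j : Fin 3,
            ((g.blockC g.leviCivita x e -
              ((g.blockC g.leviCivita x e).trace / 3) • (1 : Matrix (Fin 3) (Fin 3) ℝ)) i j) ^ 2) →
        ∫⁻ x, ENNReal.ofReal (wp x) ∂riemannianMeasure (g.toContMDiffRiemannianMetric hg) =
          ∫⁻ x, ENNReal.ofReal (wm x) ∂riemannianMeasure (g.toContMDiffRiemannianMetric hg))
    (hGB : ∀ (M : Type) [TopologicalSpace M] [T2Space M] [SecondCountableTopology M]
      [ChartedSpace (EuclideanSpace ℝ (Fin 4)) M] [IsManifold (𝓡 4) ∞ M] [CompactSpace M]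
      [T3Space M] [MeasurableSpace M] [BorelSpace M],
      M ≃ₕ Metric.sphere (0 : EuclideanSpace ℝ (Fin 5)) 1 →
      ∀ (g : PseudoRiemannianMetric (𝓡 4) ∞ (EuclideanSpace ℝ (Fin 4))
          (TangentSpace (𝓡 4) : M → Type _))
        [g.HasLeviCivita] (hg : g.IsRiemannian) (lam : ℝ), 0 < lam →
        (∀ (x : M) (X Y : TangentSpace (𝓡 4) x), g.ricci x X Y = lam * g.val x X Y) →
        ∀ (o : SmoothOrientation (𝓡 4) M) (wp wm : M → ℝ),
        (∀ x, ∃ e : Fin 4 → TangentSpace (𝓡 4) x, g.IsOrthonormalFrame x e ∧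
          o.IsPosFrame x (frameOfFin e) ∧
          wp x = (1 / 4 : ℝ) * ∑ i : Fin 3, ∑ j : Fin 3,
            ((g.blockA g.leviCivita x e -
              ((g.blockA g.leviCivita x e).trace / 3) • (1 : Matrix (Fin 3) (Fin 3) ℝ)) i j) ^ 2 ∧
          wm x = (1 / 4 : ℝ) * ∑ i : Fin 3, ∑ j : Fin 3,
            ((g.blockC g.leviCivita x e -
              ((g.blockC g.leviCivita x e).trace / 3) • (1 : Matrix (Fin 3) (Fin 3) ℝ)) i j) ^ 2) →
        ∫⁻ x, ENNReal.ofReal (wp x) ∂riemannianMeasure (g.toContMDiffRiemannianMetric hg) +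
            ∫⁻ x, ENNReal.ofReal (wm x) ∂riemannianMeasure (g.toContMDiffRiemannianMetric hg) +
            ENNReal.ofReal (2 * lam ^ 2 / 3) *
              riemannianMeasure (g.toContMDiffRiemannianMetric hg) Set.univ =
          ENNReal.ofReal (16 * Real.pi ^ 2)) :
    gursky_einstein_homotopySphere_four := by
  intro M _ _ _ _ _ _ _ _ _ hhe g _ hg lam hlam hRic
  -- `M` is simply connected, hence orientable
  haveI : SimplyConnectedSpace (Metric.sphere (0 : EuclideanSpace ℝ (Fin (4 + 1))) 1) :=
    Literature.AlgebraicTopology.FundamentalGroup.simplyConnectedSpace_euclideanSphere 4 (by norm_num)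
  haveI : SimplyConnectedSpace M := hhe.simplyConnectedSpace_iff.2 inferInstance
  obtain ⟨o⟩ := (isOrientable_of_simplyConnectedSpace_holds (I := 𝓡 4) (M := M) : IsOrientable (𝓡 4) M)
  -- a positive orthonormal frame at every point, and the chiral Weyl norms read in it
  choose e he hpos using fun x ↦ exists_isOrthonormalFrame_isPosFrame (g := g) hg o x
  set wp : M → ℝ := fun x ↦ (1 / 4 : ℝ) * ∑ i : Fin 3, ∑ j : Fin 3,
    ((g.blockA g.leviCivita x (e x) -
      ((g.blockA g.leviCivita x (e x)).trace / 3) • (1 : Matrix (Fin 3) (Fin 3) ℝ)) i j) ^ 2 with hwp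
  set wm : M → ℝ := fun x ↦ (1 / 4 : ℝ) * ∑ i : Fin 3, ∑ j : Fin 3,
    ((g.blockC g.leviCivita x (e x) -
      ((g.blockC g.leviCivita x (e x)).trace / 3) • (1 : Matrix (Fin 3) (Fin 3) ℝ)) i j) ^ 2 with hwm
  have hP : ∀ x, ∃ f : Fin 4 → TangentSpace (𝓡 4) x, g.IsOrthonormalFrame x f ∧
      o.IsPosFrame x (frameOfFin f) ∧
      wp x = (1 / 4 : ℝ) * ∑ i : Fin 3, ∑ j : Fin 3,
        ((g.blockA g.leviCivita x f -
          ((g.blockA g.leviCivita x f).trace / 3) • (1 : Matrix (Fin 3) (Fin 3) ℝ)) i j) ^ 2 :=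
    fun x ↦ ⟨e x, he x, hpos x, rfl⟩
  have hMi : ∀ x, ∃ f : Fin 4 → TangentSpace (𝓡 4) x, g.IsOrthonormalFrame x f ∧
      o.IsPosFrame x (frameOfFin f) ∧
      wm x = (1 / 4 : ℝ) * ∑ i : Fin 3, ∑ j : Fin 3,
        ((g.blockC g.leviCivita x f -
          ((g.blockC g.leviCivita x f).trace / 3) • (1 : Matrix (Fin 3) (Fin 3) ℝ)) i j) ^ 2 :=
    fun x ↦ ⟨e x, he x, hpos x, rfl⟩
  have hPM : ∀ x, ∃ f : Fin 4 → TangentSpace (𝓡 4) x, g.IsOrthonormalFrame x f ∧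
      o.IsPosFrame x (frameOfFin f) ∧
      wp x = (1 / 4 : ℝ) * ∑ i : Fin 3, ∑ j : Fin 3,
        ((g.blockA g.leviCivita x f -
          ((g.blockA g.leviCivita x f).trace / 3) • (1 : Matrix (Fin 3) (Fin 3) ℝ)) i j) ^ 2 ∧
      wm x = (1 / 4 : ℝ) * ∑ i : Fin 3, ∑ j : Fin 3,
        ((g.blockC g.leviCivita x f -
          ((g.blockC g.leviCivita x f).trace / 3) • (1 : Matrix (Fin 3) (Fin 3) ℝ)) i j) ^ 2 :=
    fun x ↦ ⟨e x, he x, hpos x, rfl, rfl⟩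
  set V := riemannianMeasure (g.toContMDiffRiemannianMetric hg) Set.univ with hV
  -- the volume conclusion from `(2λ²/3) V ≤ P`, `P' = N'`-symmetric data and (gb)
  have volume_le : ∀ {P N : ℝ≥0∞}, ENNReal.ofReal (2 * lam ^ 2 / 3) * V ≤ P → P = N →
      P + N + ENNReal.ofReal (2 * lam ^ 2 / 3) * V = ENNReal.ofReal (16 * Real.pi ^ 2) →
      V ≤ ENNReal.ofReal (8 * Real.pi ^ 2 / lam ^ 2) := by
    intro P N h1 h2 h3
    have h4 : ENNReal.ofReal (2 * lam ^ 2 / 3) * V + ENNReal.ofReal (2 * lam ^ 2 / 3) * V +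
        ENNReal.ofReal (2 * lam ^ 2 / 3) * V ≤ ENNReal.ofReal (16 * Real.pi ^ 2) := by
      calc _ ≤ P + N + ENNReal.ofReal (2 * lam ^ 2 / 3) * V :=
            add_le_add (add_le_add h1 (h2 ▸ h1)) le_rfl
        _ = _ := h3
    rw [← add_mul, ← add_mul, ← ENNReal.ofReal_add (by positivity) (by positivity),
      ← ENNReal.ofReal_add (by positivity) (by positivity),
      show 2 * lam ^ 2 / 3 + 2 * lam ^ 2 / 3 + 2 * lam ^ 2 / 3 = 2 * lam ^ 2 by ring] at h4
    have hpos2 : 0 < 2 * lam ^ 2 := by positivity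
    calc V ≤ ENNReal.ofReal (16 * Real.pi ^ 2) / ENNReal.ofReal (2 * lam ^ 2) := by
          rw [ENNReal.le_div_iff_mul_le (Or.inl (ENNReal.ofReal_pos.2 hpos2).ne')
            (Or.inl ENNReal.ofReal_ne_top), mul_comm]
          exact h4
      _ = ENNReal.ofReal (16 * Real.pi ^ 2 / (2 * lam ^ 2)) := (ENNReal.ofReal_div_of_pos hpos2).symm
      _ = ENNReal.ofReal (8 * Real.pi ^ 2 / lam ^ 2) := by
          congr 1
          field_simp
          ring
  by_cases h0 : (∀ x, wp x = 0) ∧ (∀ x, wm x = 0)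
  · -- `W⁺ ≡ 0` and `W⁻ ≡ 0` in the chosen positive frames: `W ≡ 0` in every orthonormal frame
    left
    intro x f hf i j k l
    have hn : (2 : ℕ∞ω) ≤ ((⊤ : ℕ∞) : ℕ∞ω) := WithTop.coe_le_coe.mpr le_top
    have hex : g.weylNormSqFrame x (e x) = 0 := by
      rw [weylNormSqFrame_eq_hamiltonBlocks g hn finrank_euclideanSpace_fin (he x)]
      have hA : ∑ i : Fin 3, ∑ j : Fin 3, ((g.blockA g.leviCivita x (e x) -
          ((g.blockA g.leviCivita x (e x)).trace / 3) • (1 : Matrix (Fin 3) (Fin 3) ℝ)) i j) ^ 2 = 0 := by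
        have := h0.1 x
        simp only [hwp] at this
        linarith
      have hC : ∑ i : Fin 3, ∑ j : Fin 3, ((g.blockC g.leviCivita x (e x) -
          ((g.blockC g.leviCivita x (e x)).trace / 3) • (1 : Matrix (Fin 3) (Fin 3) ℝ)) i j) ^ 2 = 0 := by
        have := h0.2 x
        simp only [hwm] at this
        linarith
      simp only [Finset.sum_add_distrib]
      rw [hA, hC, add_zero]
    have hfx : g.weylNormSqFrame x f = 0 := by
      rw [g.weylNormSqFrame_eq_of_isOrthonormalFrame hf (by simp) (he x) (by simp), hex]
    have hsq := weylFrame_sq_le_weylNormSqFrame g x f i j k l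
    rw [hfx] at hsq
    exact pow_eq_zero_iff (n := 2) (by norm_num) |>.1 (le_antisymm hsq (sq_nonneg _))
  · right
    rcases not_and_or.1 h0 with h1 | h1
    · push Not at h1
      exact volume_le (hThm1 M hhe g hg lam hlam hRic o wp hP h1)
        (hSig M hhe g hg lam hlam hRic o wp wm hPM) (hGB M hhe g hg lam hlam hRic o wp wm hPM)
    · push Not at h1
      have h2 := hSig M hhe g hg lam hlam hRic o wp wm hPM
      have h3 := hGB M hhe g hg lam hlam hRic o wp wm hPM
      rw [add_comm (∫⁻ x, ENNReal.ofReal (wp x) ∂_)] at h3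
      exact volume_le (hCor1 M hhe g hg lam hlam hRic o wm hMi h1) h2.symm h3

end Oriented

end Literature.Geometry.Riemannian

end
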